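import Literature.Analysis.OperatorTheory.PositivityImprovingSpectralGap
import Literature.Analysis.OperatorTheory.KernelIterateBridge
import Literature.Analysis.OperatorTheory.KernelSectionPositivity
import Literature.Analysis.OperatorTheory.L2WeightedPairing
import HarnessLib

/-!
# Spectral (Perron–Frobenius–Jentzsch) asymptotics of the two-arc trace integrand of a positive
# symmetric transfer kernel — PROVED

Topic `Literature/Analysis/OperatorTheory`; the spectral side of the transfer-operator treatment of
one-dimensional (or time-sliced) models with PERIODIC boundary conditions, companion of
`KernelCyclicPeeling.lean` (trace formula: the cyclic path integral with one-site insertions `F` at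
`0` and `G` at `n' + 1` on a cycle of `N = k + 1 + n' + 1` sites equals
`∫ F(x) (κ^[n'+1] (G · κ^[k] K(x, ·)))(x) dμ(x)`, `κ f = ∫ K(·, z) f(z) dμ(z)`), of
`PositiveKernelTransferOperator.lean` (the `L²` transfer operator `A`),
`PositivityImprovingSpectralGap.lean` (`‖Aⁿ g - ‖A‖ⁿ⟪φ, g⟫φ‖ ≤ θⁿ‖g‖`, `θ < ‖A‖`) and
`KernelIterateBridge.lean` (`A^j [h] =ᵐ κ^[j] h`, `⟪k_u, A^j[h]⟫ = (κ^[j+1] h)(u)`).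

For a bounded, jointly measurable, symmetric, strictly positive kernel `K` on a probability space
`(X, μ)` it PROVES (`exists_iterate_spectral_bound`, **main**) that there are `0 < θ < λ` (`λ = ‖A‖`,
`θ` a bound on the rest of the spectrum), a constant `Cₛ` and a bounded measurable version `φ₀` of
the Perron–Frobenius–Jentzsch eigenfunction (`∫ φ₀² = 1`) such that for all bounded measurable `G`,
all `k, n'` and EVERY point `x`,
`|(κ^[n'+1] (G · κ^[k] K(x,·)))(x) − λ^{n'+k+2} φ₀(x)² ∫ G φ₀²| ≤ ‖G‖_∞ Cₛ² (λ^{n'}θ^k + λ^kθ^{n'} + θ^{n'+k})`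
and, for the vacuum (no insertion), the sharper
`|(κ^[n'+1] (κ^[k] K(x,·)))(x) − λ^{n'+k+2} φ₀(x)²| ≤ Cₛ² θ^{n'+k}`.
Integrated against `F(x) dμ(x)` these are the large-`N` asymptotics
`Tr(F 𝕋^{n'+1} G 𝕋^{k+1}) = λ^N ⟨Fφ₀²⟩⟨Gφ₀²⟩ + O(λ^N (θ/λ)^{min(n'+1,k+1)})` behind exponential
clustering uniformly in the period (sequel `CyclicKernelClustering.lean`). Supporting lemmas:
uniform bounds and JOINT measurability of parametric kernel iterates
(`norm_iterate_kernel_le`, `stronglyMeasurable_uncurry_iterate_kernel`); the weighted pairing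
`∫ f G g dμ` and its rank-one expansion are `L2WeightedPairing.lean`. Mathlib + the companions
only; no definitions. [folklore]
-/

noncomputable section

open MeasureTheory Set Filter Function
open scoped RealInnerProductSpace ENNReal

namespace Literature.Analysis.OperatorTheory

variable {X : Type*} [MeasurableSpace X] {μ : Measure X}


/-! ### Parametric kernel iterates: uniform bounds and joint measurability -/

section Iterates

variable {K : X → X → ℝ} {C : ℝ}

/-- `|κ^[j] f| ≤ C^j B` pointwise if `|K| ≤ C`, `|f| ≤ B` and `μ` is a probability measure.
[folklore] -/
theorem norm_iterate_kernel_le [IsProbabilityMeasure μ] (hC : ∀ x y, ‖K x y‖ ≤ C) {f : X → ℝ}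
    {B : ℝ} (hfb : ∀ x, ‖f x‖ ≤ B) (j : ℕ) (x : X) :
    ‖((fun f : X → ℝ => fun w => ∫ z, K w z * f z ∂μ)^[j] f) x‖ ≤ C ^ j * B := by
  induction j generalizing x with
  | zero => simpa using hfb x
  | succ j ih =>
    rw [Function.iterate_succ_apply']
    calc ‖∫ z, K x z * ((fun f : X → ℝ => fun w => ∫ z, K w z * f z ∂μ)^[j] f) z ∂μ‖
        ≤ C * (C ^ j * B) * μ.real univ :=
          norm_integral_le_of_norm_le_const (Eventually.of_forall fun z => by
            rw [norm_mul]
            exact mul_le_mul (hC x z) (ih z) (norm_nonneg _) ((norm_nonneg _).trans (hC x z)))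
      _ = C ^ (j + 1) * B := by rw [probReal_univ, pow_succ]; ring

/-- One kernel integration of a jointly measurable parametric family is jointly measurable:
`(x, y) ↦ ∫ K(y, z) Ψ(x, z) dμ(z)`. [folklore] -/
theorem stronglyMeasurable_uncurry_integral_kernel_mul [SFinite μ]
    (hK : StronglyMeasurable (uncurry K)) {Ψ : X → X → ℝ} (hΨ : StronglyMeasurable (uncurry Ψ)) :
    StronglyMeasurable (uncurry fun x y => ∫ z, K y z * Ψ x z ∂μ) := by
  have h : StronglyMeasurable (uncurry fun (p : X × X) (z : X) => K p.2 z * Ψ p.1 z) :=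
    (hK.comp_measurable (measurable_fst.snd.prodMk measurable_snd)).mul
      (hΨ.comp_measurable (measurable_fst.fst.prodMk measurable_snd))
  exact h.integral_prod_right'

/-- **Joint measurability of parametric kernel iterates**: `(x, y) ↦ (κ^[j] Ψ(x, ·))(y)`.
[folklore] -/
theorem stronglyMeasurable_uncurry_iterate_kernel [SFinite μ] (hK : StronglyMeasurable (uncurry K))
    {Ψ : X → X → ℝ} (hΨ : StronglyMeasurable (uncurry Ψ)) (j : ℕ) :
    StronglyMeasurable (uncurry fun x =>
      (fun f : X → ℝ => fun w => ∫ z, K w z * f z ∂μ)^[j] (Ψ x)) := by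
  induction j with
  | zero => simpa using hΨ
  | succ j ih =>
    simp only [Function.iterate_succ_apply']
    exact stronglyMeasurable_uncurry_integral_kernel_mul hK ih

/-- The two-arc trace integrand `x ↦ (κ^[m] (G · κ^[k] K(x, ·)))(x)` is measurable (the diagonal
of a jointly measurable parametric iterate). [folklore] -/
theorem measurable_iterate_obs_iterate_section [SFinite μ] (hK : StronglyMeasurable (uncurry K))
    {G : X → ℝ} (hGm : Measurable G) (m k : ℕ) :
    Measurable fun x => (fun f : X → ℝ => fun w => ∫ z, K w z * f z ∂μ)^[m]
      (fun y => G y * (fun f : X → ℝ => fun w => ∫ z, K w z * f z ∂μ)^[k] (K x) y) x := by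
  have h1 : StronglyMeasurable (uncurry fun x =>
      (fun f : X → ℝ => fun w => ∫ z, K w z * f z ∂μ)^[k] (K x)) :=
    stronglyMeasurable_uncurry_iterate_kernel hK hK k
  have h2 : StronglyMeasurable (uncurry fun x y =>
      G y * (fun f : X → ℝ => fun w => ∫ z, K w z * f z ∂μ)^[k] (K x) y) :=
    (hGm.stronglyMeasurable.comp_measurable measurable_snd).mul h1
  have h3 := stronglyMeasurable_uncurry_iterate_kernel (μ := μ) hK h2 m
  exact h3.measurable.comp (measurable_id.prodMk measurable_id)

end Iterates

/-! ### The rank-one (Perron–Frobenius) asymptotics of the two-arc integrand -/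

section Core

variable [IsProbabilityMeasure μ] {K : X → X → ℝ} {C : ℝ} {A : Lp ℝ 2 μ →L[ℝ] Lp ℝ 2 μ}

/-- **The two-arc integrand as a weighted pairing of transfer-operator powers**:
`(κ^[n'+1] (G · κ^[k] K(x,·)))(x) = ∫ (A^{n'} k_x)(y) G(y) (A^k k_x)(y) dμ(y)` (`k_x = K(x, ·)`, `K`
symmetric, `A` the `L²` realisation of `κ`, self-adjoint). [folklore] -/
theorem iterate_obs_iterate_section_eq_integral (hK : StronglyMeasurable (uncurry K))
    (hC : ∀ x y, ‖K x y‖ ≤ C) (hsymm : ∀ x y, K x y = K y x) (hsa : IsSelfAdjoint A)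
    (hA : ∀ ψ : Lp ℝ 2 μ, (A ψ : X → ℝ) =ᵐ[μ] fun x => ∫ y, K x y * ψ y ∂μ)
    {G : X → ℝ} (hGm : Measurable G) {BG : ℝ} (hGb : ∀ y, ‖G y‖ ≤ BG) (k n' : ℕ) (x : X) :
    (fun f : X → ℝ => fun w => ∫ z, K w z * f z ∂μ)^[n' + 1]
        (fun y => G y * (fun f : X → ℝ => fun w => ∫ z, K w z * f z ∂μ)^[k] (K x) y) x =
      ∫ y, ((A ^ n') ((memLp_kernel_section (μ := μ) hK hC x).toLp (K x))) y *
        (G y * ((A ^ k) ((memLp_kernel_section (μ := μ) hK hC x).toLp (K x))) y) ∂μ := by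
  set κ : (X → ℝ) → X → ℝ := fun f w => ∫ z, K w z * f z ∂μ with hκ
  have hC0 : 0 ≤ C := (norm_nonneg _).trans (hC x x)
  have hKx : Measurable (K x) := hK.measurable.of_uncurry_left
  -- the observable `ψ = G · κ^[k] k_x`: bounded and measurable
  obtain ⟨-, hqm⟩ := exists_bound_and_measurable_kernelIterate (μ := μ) hK hC hKx ⟨C, hC x⟩ k
  have hqb : ∀ y, ‖(κ^[k] (K x)) y‖ ≤ C ^ k * C := fun y =>
    norm_iterate_kernel_le hC (fun y => hC x y) k y
  have hψm : Measurable fun y => G y * (κ^[k] (K x)) y := hGm.mul hqm.measurable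
  have hψb : ∀ y, ‖G y * (κ^[k] (K x)) y‖ ≤ BG * (C ^ k * C) := fun y => by
    rw [norm_mul]
    exact mul_le_mul (hGb y) (hqb y) (norm_nonneg _) ((norm_nonneg _).trans (hGb y))
  -- `(κ^[n'+1] ψ)(x) = ⟪k_x, A^{n'} [ψ]⟫ = ⟪A^{n'} k_x, [ψ]⟫`
  have h1 := inner_kernel_section_pow_kernelOp hK hC hsymm hA hψm hψb n' x
  change (κ^[n' + 1] fun y => G y * (κ^[k] (K x)) y) x = _
  rw [← h1, ← (hsa.pow n').isSymmetric.apply_clm, inner_eq_integral]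
  -- replace the class `[ψ]` by `G · A^k k_x` a.e.
  refine integral_congr_ae ?_
  have h2 := pow_kernelOp_toLp_ae_eq_iterate (μ := μ) hA hKx (fun y => hC x y) k
  filter_upwards [(memLp_two_of_bound (μ := μ) hψm hψb).coeFn_toLp, h2] with y hy hy2
  rw [hy]
  change _ = _ * (G y * ((A ^ k) ((memLp_two_of_bound (μ := μ) hKx fun y => hC x y).toLp (K x))) y)
  rw [hy2]

omit [IsProbabilityMeasure μ] in
/-- Powers act on an eigenvector by powers of the eigenvalue. [folklore] -/
theorem pow_apply_eq_pow_smul_of_apply_eq_smul {φ : Lp ℝ 2 μ} {lam : ℝ} (hAφ : A φ = lam • φ)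
    (j : ℕ) : (A ^ j) φ = lam ^ j • φ := by
  induction j with
  | zero => simp
  | succ j ih => rw [pow_succ', mul_apply_eq_comp, ih, map_smul, hAφ, smul_smul, ← pow_succ]

/-- **Rank-one asymptotics of the two-arc integrand, with an insertion.** If
`‖Aʲ g - λʲ⟪φ, g⟫φ‖ ≤ θʲ‖g‖` for all `j, g` (`‖φ‖ = 1`, `λ, θ ≥ 0`), then for bounded measurable `G`,
all `k, n'` and every `x`,
`|(κ^[n'+1] (G · κ^[k] K(x,·)))(x) − λ^{n'+k} ⟪φ, k_x⟫² ∫ φ G φ| ≤ ‖G‖_∞ ‖k_x‖² (λ^{n'}θ^k + λ^kθ^{n'} + θ^{n'+k})`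
(expand `A^{n'} k_x = λ^{n'}⟪φ,k_x⟫φ + r₁`, `A^k k_x = λ^k⟪φ,k_x⟫φ + r₂` in the weighted pairing).
[folklore] -/
theorem abs_iterate_obs_iterate_section_sub_le (hK : StronglyMeasurable (uncurry K))
    (hC : ∀ x y, ‖K x y‖ ≤ C) (hsymm : ∀ x y, K x y = K y x) (hsa : IsSelfAdjoint A)
    (hA : ∀ ψ : Lp ℝ 2 μ, (A ψ : X → ℝ) =ᵐ[μ] fun x => ∫ y, K x y * ψ y ∂μ)
    {φ : Lp ℝ 2 μ} (hφ1 : ‖φ‖ = 1) {lam θ : ℝ} (hlam : 0 ≤ lam) (hθ : 0 ≤ θ)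
    (hpow : ∀ (j : ℕ) (g : Lp ℝ 2 μ), ‖(A ^ j) g - (lam ^ j * ⟪φ, g⟫) • φ‖ ≤ θ ^ j * ‖g‖)
    {G : X → ℝ} (hGm : Measurable G) {BG : ℝ} (hGb : ∀ y, ‖G y‖ ≤ BG) (k n' : ℕ) (x : X) :
    |(fun f : X → ℝ => fun w => ∫ z, K w z * f z ∂μ)^[n' + 1]
          (fun y => G y * (fun f : X → ℝ => fun w => ∫ z, K w z * f z ∂μ)^[k] (K x) y) x -
        lam ^ (n' + k) * ⟪φ, (memLp_kernel_section (μ := μ) hK hC x).toLp (K x)⟫ ^ 2 *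
          ∫ y, φ y * (G y * φ y) ∂μ| ≤
      BG * ‖(memLp_kernel_section (μ := μ) hK hC x).toLp (K x)‖ ^ 2 *
        (lam ^ n' * θ ^ k + lam ^ k * θ ^ n' + θ ^ (n' + k)) := by
  set kx : Lp ℝ 2 μ := (memLp_kernel_section (μ := μ) hK hC x).toLp (K x) with hkx
  set a : ℝ := ⟪φ, kx⟫ with ha
  have hBG : 0 ≤ BG := (norm_nonneg _).trans (hGb x)
  have habs : |a| ≤ ‖kx‖ := by
    calc |a| ≤ ‖φ‖ * ‖kx‖ := abs_real_inner_le_norm _ _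
      _ = ‖kx‖ := by rw [hφ1, one_mul]
  have hr₁ : ‖(A ^ n') kx - (lam ^ n' * a) • φ‖ ≤ θ ^ n' * ‖kx‖ := hpow n' kx
  have hr₂ : ‖(A ^ k) kx - (lam ^ k * a) • φ‖ ≤ θ ^ k * ‖kx‖ := hpow k kx
  have hc₁ : |lam ^ n' * a| ≤ lam ^ n' * ‖kx‖ := by
    rw [abs_mul, abs_of_nonneg (pow_nonneg hlam _)]
    exact mul_le_mul_of_nonneg_left habs (pow_nonneg hlam _)
  have hc₂ : |lam ^ k * a| ≤ lam ^ k * ‖kx‖ := by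
    rw [abs_mul, abs_of_nonneg (pow_nonneg hlam _)]
    exact mul_le_mul_of_nonneg_left habs (pow_nonneg hlam _)
  rw [iterate_obs_iterate_section_eq_integral hK hC hsymm hsa hA hGm hGb k n' x,
    integral_mul_mul_eq_expansion hGm hGb ((A ^ n') kx) ((A ^ k) kx) φ (lam ^ n' * a) (lam ^ k * a)]
  -- the main term cancels; three remainders are left
  have hT1 : |lam ^ n' * a * ∫ y, φ y * (G y * ((A ^ k) kx - (lam ^ k * a) • φ) y) ∂μ| ≤
      BG * ‖kx‖ ^ 2 * (lam ^ n' * θ ^ k) := by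
    rw [abs_mul]
    calc |lam ^ n' * a| * |∫ y, φ y * (G y * ((A ^ k) kx - (lam ^ k * a) • φ) y) ∂μ|
        ≤ (lam ^ n' * ‖kx‖) * (BG * ‖φ‖ * ‖(A ^ k) kx - (lam ^ k * a) • φ‖) :=
          mul_le_mul hc₁ (abs_integral_mul_mul_le hGb hBG _ _) (abs_nonneg _) (by positivity)
      _ ≤ (lam ^ n' * ‖kx‖) * (BG * ‖φ‖ * (θ ^ k * ‖kx‖)) := by gcongr
      _ = BG * ‖kx‖ ^ 2 * (lam ^ n' * θ ^ k) := by rw [hφ1]; ring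
  have hT2 : |lam ^ k * a * ∫ y, ((A ^ n') kx - (lam ^ n' * a) • φ) y * (G y * φ y) ∂μ| ≤
      BG * ‖kx‖ ^ 2 * (lam ^ k * θ ^ n') := by
    rw [abs_mul]
    calc |lam ^ k * a| * |∫ y, ((A ^ n') kx - (lam ^ n' * a) • φ) y * (G y * φ y) ∂μ|
        ≤ (lam ^ k * ‖kx‖) * (BG * ‖(A ^ n') kx - (lam ^ n' * a) • φ‖ * ‖φ‖) :=
          mul_le_mul hc₂ (abs_integral_mul_mul_le hGb hBG _ _) (abs_nonneg _) (by positivity)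
      _ ≤ (lam ^ k * ‖kx‖) * (BG * (θ ^ n' * ‖kx‖) * ‖φ‖) := by gcongr
      _ = BG * ‖kx‖ ^ 2 * (lam ^ k * θ ^ n') := by rw [hφ1]; ring
  have hT3 : |∫ y, ((A ^ n') kx - (lam ^ n' * a) • φ) y *
      (G y * ((A ^ k) kx - (lam ^ k * a) • φ) y) ∂μ| ≤ BG * ‖kx‖ ^ 2 * θ ^ (n' + k) := by
    calc |∫ y, ((A ^ n') kx - (lam ^ n' * a) • φ) y * (G y * ((A ^ k) kx - (lam ^ k * a) • φ) y) ∂μ|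
        ≤ BG * ‖(A ^ n') kx - (lam ^ n' * a) • φ‖ * ‖(A ^ k) kx - (lam ^ k * a) • φ‖ :=
          abs_integral_mul_mul_le hGb hBG _ _
      _ ≤ BG * (θ ^ n' * ‖kx‖) * (θ ^ k * ‖kx‖) := by gcongr
      _ = BG * ‖kx‖ ^ 2 * θ ^ (n' + k) := by rw [pow_add]; ring
  have hmain : lam ^ n' * a * (lam ^ k * a) * ∫ y, φ y * (G y * φ y) ∂μ =
      lam ^ (n' + k) * a ^ 2 * ∫ y, φ y * (G y * φ y) ∂μ := by rw [pow_add]; ring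
  rw [hmain, add_assoc, add_assoc, add_sub_cancel_left, ← add_assoc]
  refine (abs_add_three _ _ _).trans ?_
  calc _ ≤ BG * ‖kx‖ ^ 2 * (lam ^ n' * θ ^ k) + BG * ‖kx‖ ^ 2 * (lam ^ k * θ ^ n') +
        BG * ‖kx‖ ^ 2 * θ ^ (n' + k) := add_le_add (add_le_add hT1 hT2) hT3
    _ = BG * ‖kx‖ ^ 2 * (lam ^ n' * θ ^ k + lam ^ k * θ ^ n' + θ ^ (n' + k)) := by ring

/-- **Rank-one asymptotics of the two-arc integrand, vacuum case** (no insertion): the cross terms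
vanish by orthogonality `⟪φ, rⱼ⟫ = 0`, so
`|(κ^[n'+1] (κ^[k] K(x,·)))(x) − λ^{n'+k} ⟪φ, k_x⟫²| ≤ ‖k_x‖² θ^{n'+k}`. [folklore] -/
theorem abs_iterate_iterate_section_sub_le (hK : StronglyMeasurable (uncurry K))
    (hC : ∀ x y, ‖K x y‖ ≤ C) (hsymm : ∀ x y, K x y = K y x) (hsa : IsSelfAdjoint A)
    (hA : ∀ ψ : Lp ℝ 2 μ, (A ψ : X → ℝ) =ᵐ[μ] fun x => ∫ y, K x y * ψ y ∂μ)
    {φ : Lp ℝ 2 μ} (hφ1 : ‖φ‖ = 1) {lam θ : ℝ} (hAφ : A φ = lam • φ) (hθ : 0 ≤ θ)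
    (hpow : ∀ (j : ℕ) (g : Lp ℝ 2 μ), ‖(A ^ j) g - (lam ^ j * ⟪φ, g⟫) • φ‖ ≤ θ ^ j * ‖g‖)
    (k n' : ℕ) (x : X) :
    |(fun f : X → ℝ => fun w => ∫ z, K w z * f z ∂μ)^[n' + 1]
          ((fun f : X → ℝ => fun w => ∫ z, K w z * f z ∂μ)^[k] (K x)) x -
        lam ^ (n' + k) * ⟪φ, (memLp_kernel_section (μ := μ) hK hC x).toLp (K x)⟫ ^ 2| ≤
      ‖(memLp_kernel_section (μ := μ) hK hC x).toLp (K x)‖ ^ 2 * θ ^ (n' + k) := by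
  set kx : Lp ℝ 2 μ := (memLp_kernel_section (μ := μ) hK hC x).toLp (K x) with hkx
  set a : ℝ := ⟪φ, kx⟫ with ha
  have hφφ : ⟪φ, φ⟫ = 1 := by rw [real_inner_self_eq_norm_sq, hφ1, one_pow]
  have hr₁ : ‖(A ^ n') kx - (lam ^ n' * a) • φ‖ ≤ θ ^ n' * ‖kx‖ := hpow n' kx
  have hr₂ : ‖(A ^ k) kx - (lam ^ k * a) • φ‖ ≤ θ ^ k * ‖kx‖ := hpow k kx
  -- orthogonality of the remainders
  have horth : ∀ j : ℕ, ⟪φ, (A ^ j) kx - (lam ^ j * a) • φ⟫ = 0 := fun j => by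
    rw [inner_sub_right, real_inner_smul_right, hφφ, mul_one,
      ← (hsa.pow j).isSymmetric.apply_clm, pow_apply_eq_pow_smul_of_apply_eq_smul hAφ j,
      real_inner_smul_left, sub_self]
  -- run the expansion with the trivial insertion `G = 1`
  have h1 := iterate_obs_iterate_section_eq_integral hK hC hsymm hsa hA (G := fun _ => (1 : ℝ))
    measurable_const (BG := 1) (fun y => by simp) k n' x
  have hone : (fun y => (1 : ℝ) * (fun f : X → ℝ => fun w => ∫ z, K w z * f z ∂μ)^[k] (K x) y) =
      (fun f : X → ℝ => fun w => ∫ z, K w z * f z ∂μ)^[k] (K x) := funext fun y => one_mul _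
  rw [hone] at h1
  rw [h1, integral_mul_mul_eq_expansion (BG := 1) measurable_const (fun y => by simp)
    ((A ^ n') kx) ((A ^ k) kx) φ (lam ^ n' * a) (lam ^ k * a)]
  have hI1 : ∫ y, φ y * ((1 : ℝ) * φ y) ∂μ = 1 := by
    simp_rw [one_mul]; rw [← inner_eq_integral, hφφ]
  have hI2 : ∫ y, φ y * ((1 : ℝ) * ((A ^ k) kx - (lam ^ k * a) • φ) y) ∂μ = 0 := by
    simp_rw [one_mul]; rw [← inner_eq_integral, horth k]
  have hI3 : ∫ y, ((A ^ n') kx - (lam ^ n' * a) • φ) y * ((1 : ℝ) * φ y) ∂μ = 0 := by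
    simp_rw [one_mul]; rw [← inner_eq_integral, real_inner_comm, horth n']
  rw [hI1, hI2, hI3, mul_one, mul_zero, mul_zero, add_zero, add_zero]
  have hmain : lam ^ n' * a * (lam ^ k * a) = lam ^ (n' + k) * a ^ 2 := by rw [pow_add]; ring
  rw [hmain, add_sub_cancel_left]
  calc |∫ y, ((A ^ n') kx - (lam ^ n' * a) • φ) y * ((1 : ℝ) * ((A ^ k) kx - (lam ^ k * a) • φ) y) ∂μ|
      ≤ 1 * ‖(A ^ n') kx - (lam ^ n' * a) • φ‖ * ‖(A ^ k) kx - (lam ^ k * a) • φ‖ :=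
        abs_integral_mul_mul_le (fun y => by simp) zero_le_one _ _
    _ ≤ 1 * (θ ^ n' * ‖kx‖) * (θ ^ k * ‖kx‖) := by gcongr
    _ = ‖kx‖ ^ 2 * θ ^ (n' + k) := by rw [pow_add]; ring

/-- **Spectral asymptotics of the two-arc trace integrand (package).** For a bounded, jointly
measurable, symmetric, strictly positive kernel `K` on a probability space there are `0 < θ < λ`, a
constant `Cₛ ≥ 0` and a bounded measurable `φ₀` with `∫ φ₀² = 1` (an everywhere-defined version of
the Perron–Frobenius–Jentzsch eigenfunction, namely `φ₀(x) = λ⁻¹ ∫ φ K(x, ·)`) such that for all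
bounded measurable `G`, all `k, n'` and every `x`:
`|(κ^[n'+1] (G · κ^[k] K(x,·)))(x) − λ^{n'+k+2} φ₀(x)² ∫ G φ₀²| ≤ ‖G‖_∞ Cₛ² (λ^{n'}θ^k + λ^kθ^{n'} + θ^{n'+k})`,
and in the vacuum `|(κ^[n'+1] (κ^[k] K(x,·)))(x) − λ^{n'+k+2} φ₀(x)²| ≤ Cₛ² θ^{n'+k}`
(Jentzsch's gap `PositivityImprovingSpectralGap` + the two lemmas above). [folklore] -/
theorem exists_iterate_spectral_bound (hK : StronglyMeasurable (uncurry K)) (hC : ∀ x y, ‖K x y‖ ≤ C)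
    (hsymm : ∀ x y, K x y = K y x) (hpos : ∀ x y, 0 < K x y) :
    ∃ (lam θ Cs Bφ : ℝ) (φ₀ : X → ℝ), 0 < θ ∧ θ < lam ∧ 0 ≤ Cs ∧ Measurable φ₀ ∧
      (∀ x, ‖φ₀ x‖ ≤ Bφ) ∧ ∫ x, φ₀ x ^ 2 ∂μ = 1 ∧
      (∀ (G : X → ℝ), Measurable G → ∀ (BG : ℝ), (∀ y, ‖G y‖ ≤ BG) → ∀ (k n' : ℕ) (x : X),
        |(fun f : X → ℝ => fun w => ∫ z, K w z * f z ∂μ)^[n' + 1]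
              (fun y => G y * (fun f : X → ℝ => fun w => ∫ z, K w z * f z ∂μ)^[k] (K x) y) x -
            lam ^ (n' + k + 2) * φ₀ x ^ 2 * ∫ y, G y * φ₀ y ^ 2 ∂μ| ≤
          BG * Cs ^ 2 * (lam ^ n' * θ ^ k + lam ^ k * θ ^ n' + θ ^ (n' + k))) ∧
      (∀ (k n' : ℕ) (x : X),
        |(fun f : X → ℝ => fun w => ∫ z, K w z * f z ∂μ)^[n' + 1]
              ((fun f : X → ℝ => fun w => ∫ z, K w z * f z ∂μ)^[k] (K x)) x -
            lam ^ (n' + k + 2) * φ₀ x ^ 2| ≤ Cs ^ 2 * θ ^ (n' + k)) := by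
  have hμ : μ ≠ 0 := IsProbabilityMeasure.ne_zero μ
  obtain ⟨A, hA, hsa, hc, himp, h0⟩ := exists_transferOperator (μ := μ) hK hC hsymm hpos hμ
  obtain ⟨φ, hφ1, hφpos, hAφ, θ, hθ0, hθ, hpow⟩ := himp.exists_norm_pow_sub_le hsa hc h0
  set lam : ℝ := ‖A‖ with hlam
  have hlam0 : 0 < lam := norm_pos_iff.2 h0
  -- enlarge `θ` to make it positive
  set θ₁ : ℝ := max θ (lam / 2) with hθ₁
  have hθ₁0 : 0 < θ₁ := lt_of_lt_of_le (half_pos hlam0) (le_max_right _ _)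
  have hθ₁lam : θ₁ < lam := max_lt hθ (half_lt_self hlam0)
  have hpow₁ : ∀ (j : ℕ) (g : Lp ℝ 2 μ), ‖(A ^ j) g - (lam ^ j * ⟪φ, g⟫) • φ‖ ≤ θ₁ ^ j * ‖g‖ :=
    fun j g => (hpow j g).trans (mul_le_mul_of_nonneg_right
      (pow_le_pow_left₀ hθ0 (le_max_left _ _) j) (norm_nonneg _))
  -- kernel sections and the version `φ₀` of the eigenfunction
  have hC0 : 0 ≤ C := by
    obtain ⟨x, -⟩ := nonempty_of_measure_ne_zero (fun h => hμ (Measure.measure_univ_eq_zero.1 h))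
    exact (norm_nonneg _).trans (hC x x)
  set Cs : ℝ := (measureUnivNNReal μ : ℝ) ^ (2 : ℝ≥0∞).toReal⁻¹ * C with hCs
  have hks : ∀ x, ‖(memLp_kernel_section (μ := μ) hK hC x).toLp (K x)‖ ≤ Cs := fun x =>
    norm_kernel_section_le hK hC hC0 x
  have hCs0 : 0 ≤ Cs := by rw [hCs]; positivity
  set φ₀ : X → ℝ := fun x => lam⁻¹ * ⟪φ, (memLp_kernel_section (μ := μ) hK hC x).toLp (K x)⟫
    with hφ₀
  have hφ₀m : Measurable φ₀ := (measurable_inner_kernel_section hK hC φ).const_mul _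
  have hφ₀b : ∀ x, ‖φ₀ x‖ ≤ lam⁻¹ * Cs := fun x => by
    rw [hφ₀]; dsimp only
    rw [norm_mul, Real.norm_of_nonneg (inv_nonneg.2 hlam0.le)]
    refine mul_le_mul_of_nonneg_left ?_ (inv_nonneg.2 hlam0.le)
    calc ‖⟪φ, (memLp_kernel_section (μ := μ) hK hC x).toLp (K x)⟫‖
        ≤ ‖φ‖ * ‖(memLp_kernel_section (μ := μ) hK hC x).toLp (K x)‖ := norm_inner_le_norm _ _
      _ ≤ 1 * Cs := by rw [hφ1]; exact mul_le_mul_of_nonneg_left (hks x) zero_le_one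
      _ = Cs := one_mul _
  have hinner : ∀ x, ⟪φ, (memLp_kernel_section (μ := μ) hK hC x).toLp (K x)⟫ = lam * φ₀ x :=
    fun x => by rw [hφ₀]; dsimp only; rw [← mul_assoc, mul_inv_cancel₀ hlam0.ne', one_mul]
  -- `φ₀ = φ` almost everywhere
  have hae : ∀ᵐ x ∂μ, φ₀ x = φ x := by
    filter_upwards [hA φ, Lp.coeFn_smul lam φ] with x hx hsm
    have h1 : ⟪φ, (memLp_kernel_section (μ := μ) hK hC x).toLp (K x)⟫ = (A φ) x := by
      rw [inner_kernel_section hK hC φ x, hx]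
      exact integral_congr_ae (Eventually.of_forall fun y => mul_comm _ _)
    rw [hAφ] at h1
    rw [hφ₀]; dsimp only
    rw [h1, hsm, Pi.smul_apply, smul_eq_mul, ← mul_assoc, inv_mul_cancel₀ hlam0.ne', one_mul]
  have hnorm : ∫ x, φ₀ x ^ 2 ∂μ = 1 := by
    have h1 : ∫ x, φ₀ x ^ 2 ∂μ = ∫ x, φ x * φ x ∂μ :=
      integral_congr_ae (by filter_upwards [hae] with x hx; rw [hx, sq])
    rw [h1, ← inner_eq_integral, real_inner_self_eq_norm_sq, hφ1, one_pow]
  refine ⟨lam, θ₁, Cs, lam⁻¹ * Cs, φ₀, hθ₁0, hθ₁lam, hCs0, hφ₀m, hφ₀b, hnorm,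
    fun G hGm BG hGb k n' x => ?_, fun k n' x => ?_⟩
  · -- with insertion
    have h := abs_iterate_obs_iterate_section_sub_le hK hC hsymm hsa hA hφ1 hlam0.le hθ₁0.le hpow₁
      hGm hGb k n' x
    have hBG : 0 ≤ BG := (norm_nonneg _).trans (hGb x)
    have hI : ∫ y, φ y * (G y * φ y) ∂μ = ∫ y, G y * φ₀ y ^ 2 ∂μ :=
      integral_congr_ae (by filter_upwards [hae] with y hy; rw [hy]; ring)
    have hmain : lam ^ (n' + k) * ⟪φ, (memLp_kernel_section (μ := μ) hK hC x).toLp (K x)⟫ ^ 2 *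
        ∫ y, φ y * (G y * φ y) ∂μ = lam ^ (n' + k + 2) * φ₀ x ^ 2 * ∫ y, G y * φ₀ y ^ 2 ∂μ := by
      rw [hinner, hI]; ring
    rw [hmain] at h
    refine h.trans ?_
    have hfac : 0 ≤ lam ^ n' * θ₁ ^ k + lam ^ k * θ₁ ^ n' + θ₁ ^ (n' + k) := by positivity
    have hsq : ‖(memLp_kernel_section (μ := μ) hK hC x).toLp (K x)‖ ^ 2 ≤ Cs ^ 2 :=
      pow_le_pow_left₀ (norm_nonneg _) (hks x) 2
    exact mul_le_mul_of_nonneg_right (mul_le_mul_of_nonneg_left hsq hBG) hfac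
  · -- vacuum
    have h := abs_iterate_iterate_section_sub_le hK hC hsymm hsa hA hφ1 hAφ hθ₁0.le hpow₁ k n' x
    have hmain : lam ^ (n' + k) * ⟪φ, (memLp_kernel_section (μ := μ) hK hC x).toLp (K x)⟫ ^ 2 =
        lam ^ (n' + k + 2) * φ₀ x ^ 2 := by rw [hinner]; ring
    rw [hmain] at h
    refine h.trans ?_
    have hsq : ‖(memLp_kernel_section (μ := μ) hK hC x).toLp (K x)‖ ^ 2 ≤ Cs ^ 2 :=
      pow_le_pow_left₀ (norm_nonneg _) (hks x) 2
    exact mul_le_mul_of_nonneg_right hsq (by positivity)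

end Core


end Literature.Analysis.OperatorTheory

end
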